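import Summits.Ventures.PercRepro.ProfileFlatUpsetLineSwap

/-!
# PercRepro — (G) AT THE PRINCIPAL UP-SET OF A TWO-POINT LINE OF A RANK-5 MATROID ON 8 POINTS («p on a triangle» at rank 5)
(p10, gen 20; `proofs/P10-AVFULL.md` §28)

`M` of rank `5` on `8 = 2r − 2` points, `F₀ = {e, f}` a flat of rank `2`: the first open cell of (G) at principal
up-sets after the corank-`≤ 2` capstone of gen 19 (here the corank is `3`; in pointed language the point `p` placed
freely on `F₀` lies on the triangle `{e, f, p}`).  THE DOUBLE COUNTING `#depL ≤ #bothL` on `Z ⊆ B`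
(`Finset.card_mul_le_card_mul`): a `depL` set `B` lies above `#((B ∖ F₀) ∖ cl ((E ∖ B) ∪ F₀)) ≥ 2` sets of `bothL`
when `M` has no coloop — a lone such point would be a coloop (`erase_mem_bothL_of_mem_depL`,
`two_le_card_bipartiteAbove_depL`); a `bothL` set `Z` lies below at most `r − 3 = 2` sets of `depL` — the points
`x ∈ E ∖ Z` with `(E ∖ Z ∖ x) ∪ F₀` of rank `r − 1` are coloops of `(E ∖ Z) ∪ F₀`, and three of them would leave a
set `{x₄, e, f}` of rank `2`, i.e. `x₄ ∈ cl F₀ = F₀` (`card_eraseDep_le_two`).  With the swap injections of the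
`LineSwap` module the spanned class `(B) ∪ (D)` of `e` is non-negative (`sum_sepBD_nonneg_of_no_coloop`) and the
114th module's reduction closes the no-coloop case; a coloop `y ∉ F₀` forces `y ∈ E ∖ Z` for every negative `Z` and
`Z ↦ Z ∪ y` injects (`card_negTwo_le_card_posTwo_of_coloop_notMem`); a coloop `y ∈ F₀` is the `LineSwap` module's
class-`(C)` case.  THEOREM `sum_sepSets_principal_line_rank_five_nonneg`.  At `r ≥ 6` the same double counting
fails by degrees (own census on random linear matroids at `n = 10`): nothing is asserted beyond rank `5`.
-/

open scoped Matroid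

namespace PercRepro.Cogirth

open Finset ThmH Skew

variable {α : Type} [DecidableEq α] {M : Matroid α} [M.Finite]

/-! ### The double counting `#dep ≤ #both` on `Z ⊆ B` -/

/-- Erasing from a `dep` set `B` a point `x ∉ F₀` outside `cl ((E ∖ B) ∪ F₀)` gives a set of `both`. -/
theorem erase_mem_bothL_of_mem_depL {F₀ : Finset α} (hF : IsFlatF M F₀) {e f : α} (hF₀ : F₀ = {e, f})
    {B : Finset α} (hB : B ∈ depL M F₀ e f) {x : α} (hxB : x ∈ B) (hxF : x ∉ F₀)
    (hxH : x ∉ clF M ((gr M \ B) ∪ F₀)) : B.erase x ∈ bothL M F₀ e f := by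
  rw [mem_depL] at hB
  obtain ⟨hBp, hFB, hecl, hfcl, _⟩ := hB
  obtain ⟨hBs, hBc⟩ := mem_posTwo.1 hBp
  have hBb : B ∈ biIndepAll M := (mem_sepSets.1 hBs).1
  obtain ⟨hBg, _, hBcr⟩ := mem_biIndepAll.1 hBb
  have heF : e ∈ F₀ := by rw [hF₀]; exact mem_insert_self e {f}
  have hfF : f ∈ F₀ := by rw [hF₀]; exact mem_insert_of_mem (mem_singleton_self f)
  have heg : e ∈ gr M := hF.1 heF
  have hfg : f ∈ gr M := hF.1 hfF
  have hxg : x ∈ gr M := hBg hxB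
  have hxcl : x ∉ clF M (gr M \ B) := fun h => hxH (clF_mono_fu subset_union_left h)
  have hxB' : x ∉ gr M \ B := fun h => (mem_sdiff.1 h).2 hxB
  have hcomp : gr M \ B.erase x = insert x (gr M \ B) := sdiff_erase hxg
  -- `e, f ∉ cl ((E ∖ B) ∪ x)`
  have hnot : ∀ g, g ∈ gr M → g ∈ F₀ → g ∉ clF M (gr M \ B) → g ∉ clF M (insert x (gr M \ B)) := by
    intro g hg hgF hgcl
    have hgB' : g ∉ gr M \ B := fun h => (mem_sdiff.1 h).2 (hFB hgF)
    apply notMem_clF_insert_of_notMem_clF_insert hg hxg sdiff_subset hBcr hgB' hgcl hxB'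
    intro h
    apply hxH
    exact clF_mono_fu (insert_subset (mem_union_right _ hgF) subset_union_left) h
  have hFZ : F₀ ⊆ B.erase x := fun y hy => mem_erase.2 ⟨fun h => hxF (h ▸ hy), hFB hy⟩
  rw [mem_bothL, mem_negTwo, mem_sepSets, hcomp]
  refine ⟨⟨⟨(erase_mem_biIndepAll_iff hBb hxB).2 hxcl, ?_, ?_⟩, ?_⟩, hFZ, hnot e heg heF hecl,
    hnot f hfg hfF hfcl⟩
  · exact clF_mem_principalUp_of_subset (hFZ.trans (subset_clF_fu ((erase_subset x B).trans hBg)))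
  · intro hcon
    rw [mem_principalUp] at hcon
    exact hnot e heg heF hecl (hcon.2.2 heF)
  · rw [card_erase_of_mem hxB, hBc]
    have : 1 ≤ rk M (gr M) := by
      have := rk_mono_fu (M := M) hBg
      rw [(mem_biIndepAll.1 hBb).2.1, hBc] at this
      have h0 : 0 < B.card := card_pos.2 ⟨x, hxB⟩
      omega
    omega

/-- Without coloops a `dep` set lies above at least two sets of `both`. -/
theorem two_le_card_bipartiteAbove_depL {F₀ : Finset α} (hF : IsFlatF M F₀) {e f : α} (hF₀ : F₀ = {e, f})
    (hA : ∀ y ∈ gr M, rk M ((gr M).erase y) = rk M (gr M)) {B : Finset α} (hB : B ∈ depL M F₀ e f) :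
    2 ≤ ((bothL M F₀ e f).bipartiteAbove (fun (B Z : Finset α) => Z ⊆ B) B).card := by
  have hB' := hB
  rw [mem_depL] at hB'
  obtain ⟨hBp, hFB, _, _, hdep⟩ := hB'
  have hBg : B ⊆ gr M := (mem_biIndepAll.1 (mem_sepSets.1 (mem_posTwo.1 hBp).1).1).1
  -- the candidate points
  set X := (B \ F₀).filter (fun x => x ∉ clF M ((gr M \ B) ∪ F₀)) with hX
  have hXcard : X.card ≤ ((bothL M F₀ e f).bipartiteAbove (fun (B Z : Finset α) => Z ⊆ B) B).card := by
    apply card_le_card_of_injOn (fun x => B.erase x)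
    · intro x hx
      rw [mem_coe, hX, mem_filter, mem_sdiff] at hx
      rw [mem_coe, mem_bipartiteAbove]
      exact ⟨erase_mem_bothL_of_mem_depL hF hF₀ hB hx.1.1 hx.1.2 hx.2, erase_subset x B⟩
    · intro x hx y hy hxy
      rw [mem_coe, hX, mem_filter, mem_sdiff] at hx hy
      have hxy' : B.erase x = B.erase y := hxy
      by_contra hne
      have : x ∈ B.erase y := mem_erase.2 ⟨hne, hx.1.1⟩
      rw [← hxy'] at this
      exact (mem_erase.1 this).1 rfl
  refine le_trans ?_ hXcard
  -- every point outside `X` lies in the hyperplane `H = cl ((E ∖ B) ∪ F₀)`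
  have hH : rk M (clF M ((gr M \ B) ∪ F₀)) + 1 = rk M (gr M) := by rw [rk_clF_eq_fu]; exact hdep
  have hsub : ∀ z ∈ gr M, z ∉ X → z ∈ clF M ((gr M \ B) ∪ F₀) := by
    intro z hz hzX
    by_cases hzB : z ∈ B
    · by_cases hzF : z ∈ F₀
      · exact subset_clF_fu (union_subset sdiff_subset hF.1) (mem_union_right _ hzF)
      · by_contra hcon
        exact hzX (by rw [hX, mem_filter, mem_sdiff]; exact ⟨⟨hzB, hzF⟩, hcon⟩)
    · exact subset_clF_fu (union_subset sdiff_subset hF.1) (mem_union_left _ (mem_sdiff.2 ⟨hz, hzB⟩))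
  by_contra hlt
  have hle : X.card ≤ 1 := by omega
  rcases Nat.eq_zero_or_pos X.card with h0 | hpos
  · -- `X = ∅`: the ground set lies in a hyperplane
    have hall : gr M ⊆ clF M ((gr M \ B) ∪ F₀) := fun z hz =>
      hsub z hz (fun hzX => by rw [card_eq_zero.1 h0] at hzX; exact notMem_empty z hzX)
    have := rk_mono_fu (M := M) hall
    omega
  · -- `X = {x}`: the ground set minus `x` lies in a hyperplane, so `x` is a coloop
    have h1 : X.card = 1 := by omega
    obtain ⟨x, hx⟩ := card_eq_one.1 h1
    have hxX : x ∈ X := by rw [hx]; exact mem_singleton_self x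
    have hxg : x ∈ gr M := by
      rw [hX, mem_filter, mem_sdiff] at hxX; exact hBg hxX.1.1
    have hall : (gr M).erase x ⊆ clF M ((gr M \ B) ∪ F₀) := by
      intro z hz
      rw [mem_erase] at hz
      exact hsub z hz.2 (fun hzX => by rw [hx, mem_singleton] at hzX; exact hz.1 hzX)
    have := rk_mono_fu (M := M) hall
    rw [hA x hxg] at this
    omega

/-- The points `x ∈ E ∖ Z` whose removal makes `(E ∖ Z) ∪ F₀` drop in rank. -/
noncomputable def eraseDep (M : Matroid α) [M.Finite] (F₀ Z : Finset α) : Finset α :=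
  (gr M \ Z).filter (fun x => rk M (((gr M \ Z).erase x) ∪ F₀) + 1 = rk M (gr M))

/-- A `dep` set above a set `Z` of `both` is `Z ∪ x` with `x ∈ eraseDep`. -/
theorem bipartiteBelow_depL_subset_image {F₀ Z : Finset α} {e f : α} (hZ : Z ∈ bothL M F₀ e f) :
    (depL M F₀ e f).bipartiteBelow (fun (B Z : Finset α) => Z ⊆ B) Z ⊆
      (eraseDep M F₀ Z).image (fun x => insert x Z) := by
  intro B hB
  rw [mem_bipartiteBelow] at hB
  obtain ⟨hBd, hZB⟩ := hB
  rw [mem_depL] at hBd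
  obtain ⟨hBp, _, _, _, hdep⟩ := hBd
  obtain ⟨hBs, hBc⟩ := mem_posTwo.1 hBp
  have hBg : B ⊆ gr M := (mem_biIndepAll.1 (mem_sepSets.1 hBs).1).1
  have hZc : Z.card + 1 = rk M (gr M) := (mem_negTwo.1 (mem_bothL.1 hZ).1).2
  have hone : (B \ Z).card = 1 := by rw [card_sdiff_of_subset hZB]; omega
  obtain ⟨x, hx⟩ := card_eq_one.1 hone
  have hxmem : x ∈ B \ Z := by rw [hx]; exact mem_singleton_self x
  rw [mem_sdiff] at hxmem
  have hBeq : B = insert x Z := by rw [insert_eq, ← hx, sdiff_union_of_subset hZB]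
  have hcomp : gr M \ B = (gr M \ Z).erase x := by rw [hBeq, sdiff_insert]
  rw [mem_image]
  refine ⟨x, ?_, hBeq.symm⟩
  unfold eraseDep
  rw [mem_filter, mem_sdiff]
  refine ⟨⟨hBg hxmem.1, hxmem.2⟩, ?_⟩
  rw [← hcomp]
  exact hdep

/-- At rank `5`, a set of `both` has at most two points in `eraseDep`: three such points would be coloops of
`(E ∖ Z) ∪ F₀`, leaving a set `{x₄, e, f}` of rank `2`, i.e. `x₄ ∈ cl F₀ = F₀`. -/
theorem card_eraseDep_le_two {F₀ : Finset α} (hF : IsFlatF M F₀) (hN : (gr M).card + 2 = 2 * rk M (gr M))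
    {e f : α} (hef : e ≠ f) (hF₀ : F₀ = {e, f}) (hrF : rk M F₀ = 2) (hr : rk M (gr M) = 5) {Z : Finset α}
    (hZ : Z ∈ bothL M F₀ e f) : (eraseDep M F₀ Z).card ≤ 2 := by
  rw [mem_bothL] at hZ
  obtain ⟨hZn, hFZ, hecl, _⟩ := hZ
  obtain ⟨hZs, hZc⟩ := mem_negTwo.1 hZn
  obtain ⟨_, _, hsum⟩ := bounds_of_mem_sepSets_principal hF hZs
  obtain ⟨hZg, _, hZcr⟩ := mem_biIndepAll.1 (mem_sepSets.1 hZs).1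
  have heF : e ∈ F₀ := by rw [hF₀]; exact mem_insert_self e {f}
  have heg : e ∈ gr M := hF.1 heF
  have hF₀c : F₀.card = 2 := by rw [hF₀]; exact card_pair hef
  have hdisj : Disjoint (gr M \ Z) F₀ := by
    rw [disjoint_left]
    intro y hy hyF
    exact (mem_sdiff.1 hy).2 (hFZ hyF)
  -- `D = (E ∖ Z) ∪ F₀` has `r + 1` points and rank `r`
  set D := (gr M \ Z) ∪ F₀ with hD
  have hDg : D ⊆ gr M := union_subset sdiff_subset hF.1
  have hDc : D.card = 6 := by
    rw [hD, card_union_of_disjoint hdisj, hF₀c]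
    omega
  have hDr : rk M D = 5 := by
    have henot : e ∉ gr M \ Z := fun h => (mem_sdiff.1 h).2 (hFZ heF)
    have h1 : rk M (insert e (gr M \ Z)) = (insert e (gr M \ Z)).card :=
      rk_insert_eq_card_of_notMem_clF heg sdiff_subset hZcr henot hecl
    rw [card_insert_of_notMem henot] at h1
    have h2 : rk M (insert e (gr M \ Z)) ≤ rk M D :=
      rk_mono_fu (insert_subset (mem_union_right _ heF) subset_union_left)
    have h3 : rk M D ≤ rk M (gr M) := rk_mono_fu hDg
    omega
  -- a point of `eraseDep` is a coloop of `D`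
  have hcol : ∀ x ∈ eraseDep M F₀ Z, x ∈ D ∧ x ∉ F₀ ∧ rk M (D.erase x) + 1 = rk M D := by
    intro x hx
    unfold eraseDep at hx
    rw [mem_filter] at hx
    have hxF : x ∉ F₀ := fun h => (mem_sdiff.1 hx.1).2 (hFZ h)
    refine ⟨mem_union_left _ hx.1, hxF, ?_⟩
    have : D.erase x = (gr M \ Z).erase x ∪ F₀ := by
      rw [hD, erase_union_distrib, erase_eq_of_notMem hxF]
    rw [this, hx.2, hDr, hr]
  by_contra hcon
  obtain ⟨x₁, hx₁, x₂, hx₂, x₃, hx₃, h12, h13, h23⟩ :=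
    two_lt_card.1 (show 2 < (eraseDep M F₀ Z).card by omega)
  obtain ⟨hx₁D, hx₁F, hco₁⟩ := hcol x₁ hx₁
  obtain ⟨hx₂D, hx₂F, hco₂⟩ := hcol x₂ hx₂
  obtain ⟨hx₃D, hx₃F, hco₃⟩ := hcol x₃ hx₃
  -- peel the three coloops
  have hD₁r : rk M (D.erase x₁) = 4 := by omega
  have hx₂D₁ : x₂ ∈ D.erase x₁ := mem_erase.2 ⟨h12.symm, hx₂D⟩
  have hD₂r : rk M ((D.erase x₁).erase x₂) = 3 := by
    have := rk_erase_of_coloop_subset hDg (erase_subset x₁ D) hx₂D₁ hco₂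
    omega
  have hx₃D₂ : x₃ ∈ (D.erase x₁).erase x₂ := mem_erase.2 ⟨h23.symm, mem_erase.2 ⟨h13.symm, hx₃D⟩⟩
  have hWr : rk M (((D.erase x₁).erase x₂).erase x₃) = 2 := by
    have := rk_erase_of_coloop_subset hDg ((erase_subset x₂ (D.erase x₁)).trans (erase_subset x₁ D)) hx₃D₂ hco₃
    omega
  have hWc : (((D.erase x₁).erase x₂).erase x₃).card = 3 := by
    rw [card_erase_of_mem hx₃D₂, card_erase_of_mem hx₂D₁, card_erase_of_mem hx₁D, hDc]
  set W := ((D.erase x₁).erase x₂).erase x₃ with hW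
  have hFW : F₀ ⊆ W := by
    intro y hy
    have hyD : y ∈ D := mem_union_right _ hy
    exact mem_erase.2 ⟨fun h => hx₃F (h ▸ hy), mem_erase.2 ⟨fun h => hx₂F (h ▸ hy),
      mem_erase.2 ⟨fun h => hx₁F (h ▸ hy), hyD⟩⟩⟩
  have hWg : W ⊆ gr M := ((erase_subset x₃ _).trans ((erase_subset x₂ _).trans (erase_subset x₁ D))).trans hDg
  -- `W ∖ F₀` is a single point `x₄`, and `W = F₀ ∪ x₄` has rank `2 = rk F₀`
  have hV : (W \ F₀).card = 1 := by rw [card_sdiff_of_subset hFW, hWc, hF₀c]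
  obtain ⟨x₄, hx₄⟩ := card_eq_one.1 hV
  have hx₄mem : x₄ ∈ W \ F₀ := by rw [hx₄]; exact mem_singleton_self x₄
  rw [mem_sdiff] at hx₄mem
  have hWeq : W = insert x₄ F₀ := by rw [insert_eq, ← hx₄, sdiff_union_of_subset hFW]
  have hx₄cl : x₄ ∈ clF M F₀ := by
    rw [mem_clF_iff_rk_insert_eq (hWg hx₄mem.1) hF.1, ← hWeq, hWr, hrF]
  rw [hF.2] at hx₄cl
  exact hx₄mem.2 hx₄cl

/-- A set of `both` lies below at most two sets of `dep` (rank `5`). -/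
theorem card_bipartiteBelow_depL_le_two {F₀ : Finset α} (hF : IsFlatF M F₀)
    (hN : (gr M).card + 2 = 2 * rk M (gr M)) {e f : α} (hef : e ≠ f) (hF₀ : F₀ = {e, f}) (hrF : rk M F₀ = 2)
    (hr : rk M (gr M) = 5) {Z : Finset α} (hZ : Z ∈ bothL M F₀ e f) :
    ((depL M F₀ e f).bipartiteBelow (fun (B Z : Finset α) => Z ⊆ B) Z).card ≤ 2 :=
  (card_le_card (bipartiteBelow_depL_subset_image hZ)).trans
    (card_image_le.trans (card_eraseDep_le_two hF hN hef hF₀ hrF hr hZ))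

/-- **`#dep ≤ #both`** at rank `5` without coloops, by double counting `Z ⊆ B`. -/
theorem card_depL_le_card_bothL {F₀ : Finset α} (hF : IsFlatF M F₀) (hN : (gr M).card + 2 = 2 * rk M (gr M))
    {e f : α} (hef : e ≠ f) (hF₀ : F₀ = {e, f}) (hrF : rk M F₀ = 2) (hr : rk M (gr M) = 5)
    (hA : ∀ y ∈ gr M, rk M ((gr M).erase y) = rk M (gr M)) :
    (depL M F₀ e f).card ≤ (bothL M F₀ e f).card := by
  have h := card_mul_le_card_mul (fun (B Z : Finset α) => Z ⊆ B) (s := depL M F₀ e f) (t := bothL M F₀ e f)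
    (m := 2) (n := 2) (fun B hB => two_le_card_bipartiteAbove_depL hF hF₀ hA hB)
    (fun Z hZ => card_bipartiteBelow_depL_le_two hF hN hef hF₀ hrF hr hZ)
  omega

/-! ### The spanned class `(B) ∪ (D)` of `e` is non-negative, and the coloop cases -/

/-- Without coloops the class `(B) ∪ (D)` of `e` has non-negative weight. -/
theorem sum_sepBD_nonneg_of_no_coloop {F₀ : Finset α} (hF : IsFlatF M F₀)
    (hN : (gr M).card + 2 = 2 * rk M (gr M)) {e f : α} (hef : e ≠ f) (hF₀ : F₀ = {e, f}) (hrF : rk M F₀ = 2)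
    (hr : rk M (gr M) = 5) (hA : ∀ y ∈ gr M, rk M ((gr M).erase y) = rk M (gr M)) :
    0 ≤ ∑ Z ∈ sepB M (principalUp M F₀) e, (2 * (Z.card : ℤ) - (gr M).card - 1) +
      ∑ Z ∈ sepD M (principalUp M F₀) e, (2 * (Z.card : ℤ) - (gr M).card - 1) := by
  have hB : sepB M (principalUp M F₀) e ⊆ sepSets M (principalUp M F₀) := by unfold sepB; exact filter_subset _ _
  have hD : sepD M (principalUp M F₀) e ⊆ sepSets M (principalUp M F₀) := by unfold sepD; exact filter_subset _ _
  rw [sum_term_eq_of_subset hF hN hB, sum_term_eq_of_subset hF hN hD]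
  have h1 := card_negB_le hF hN hF₀
  have h2 := card_depL_le_card_bothL hF hN hef hF₀ hrF hr hA
  have h3 := card_bothL_union_negD_le hF hN hef hF₀
  rw [card_union_of_disjoint disjoint_bothL_negD] at h3
  unfold negB posB negD posD at *
  have h1' : ((sepB M (principalUp M F₀) e).filter (fun Z => Z ∈ negTwo M F₀)).card ≤
      ((sepD M (principalUp M F₀) e).filter (fun Z => Z ∈ posTwo M F₀)).card + (bothL M F₀ e f).card := by
    omega
  have h4 : ((sepB M (principalUp M F₀) e).filter (fun Z => Z ∈ negTwo M F₀)).card +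
      ((sepD M (principalUp M F₀) e).filter (fun Z => Z ∈ negTwo M F₀)).card ≤
      ((sepB M (principalUp M F₀) e).filter (fun Z => Z ∈ posTwo M F₀)).card +
      ((sepD M (principalUp M F₀) e).filter (fun Z => Z ∈ posTwo M F₀)).card := by omega
  have h4' : (((sepB M (principalUp M F₀) e).filter (fun Z => Z ∈ negTwo M F₀)).card : ℤ) +
      ((sepD M (principalUp M F₀) e).filter (fun Z => Z ∈ negTwo M F₀)).card ≤
      ((sepB M (principalUp M F₀) e).filter (fun Z => Z ∈ posTwo M F₀)).card +
      ((sepD M (principalUp M F₀) e).filter (fun Z => Z ∈ posTwo M F₀)).card := by exact_mod_cast h4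
  linarith

/-- With a coloop `y ∉ F₀`, `Z ↦ Z ∪ y` injects the negative sets into the positive ones. -/
theorem card_negTwo_le_card_posTwo_of_coloop_notMem {F₀ : Finset α} (hF : IsFlatF M F₀)
    (hN : (gr M).card + 2 = 2 * rk M (gr M)) {y : α} (hy : y ∈ gr M) (hyF : y ∉ F₀)
    (hco : rk M ((gr M).erase y) + 1 = rk M (gr M)) : (negTwo M F₀).card ≤ (posTwo M F₀).card := by
  have key : ∀ Z ∈ negTwo M F₀, y ∉ Z ∧ y ∉ clF M Z := by
    intro Z hZ
    obtain ⟨hZs, hc⟩ := mem_negTwo.1 hZ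
    obtain ⟨_, hout⟩ := subset_clF_of_mem_sepSets_principal hZs
    obtain ⟨_, _, hsum⟩ := bounds_of_mem_sepSets_principal hF hZs
    obtain ⟨hZg, _, hZcr⟩ := mem_biIndepAll.1 (mem_sepSets.1 hZs).1
    have hyZ : y ∉ Z := by
      intro hyZ
      apply hout
      have hsub : gr M \ Z ⊆ (gr M).erase y := fun z hz =>
        mem_erase.2 ⟨fun h => (mem_sdiff.1 hz).2 (h ▸ hyZ), (mem_sdiff.1 hz).1⟩
      have hrk : rk M ((gr M).erase y) ≤ rk M (gr M \ Z) := by rw [hZcr]; omega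
      have hF₀sub : F₀ ⊆ (gr M).erase y := fun z hz => mem_erase.2 ⟨fun (h : z = y) => hyF (h ▸ hz), hF.1 hz⟩
      exact hF₀sub.trans (subset_clF_of_rk_le (erase_subset _ _) hsub hrk)
    exact ⟨hyZ, notMem_clF_of_coloop hy hco (fun z hz => mem_erase.2 ⟨fun h => hyZ (h ▸ hz), hZg hz⟩)⟩
  apply card_le_card_of_injOn (fun Z => insert y Z)
  · intro Z hZ
    rw [mem_coe] at hZ
    obtain ⟨hyZ, hycl⟩ := key Z hZ
    obtain ⟨hZs, hc⟩ := mem_negTwo.1 hZ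
    obtain ⟨hin, hout⟩ := subset_clF_of_mem_sepSets_principal hZs
    have hZb : Z ∈ biIndepAll M := (mem_sepSets.1 hZs).1
    rw [mem_coe, mem_posTwo, mem_sepSets]
    refine ⟨⟨(insert_mem_biIndepAll_iff hZb hy hyZ).2 hycl, ?_, ?_⟩, by rw [card_insert_of_notMem hyZ]; exact hc⟩
    · exact clF_mem_principalUp_of_subset (hin.trans (clF_mono_fu (subset_insert y Z)))
    · intro hcon
      rw [mem_principalUp] at hcon
      apply hout
      exact hcon.2.2.trans (clF_mono_fu (sdiff_subset_sdiff (Subset.refl _) (subset_insert y Z)))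
  · intro Z₁ hZ₁ Z₂ hZ₂ heq
    rw [mem_coe] at hZ₁ hZ₂
    have heq' : insert y Z₁ = insert y Z₂ := heq
    rw [← erase_insert (key Z₁ hZ₁).1, ← erase_insert (key Z₂ hZ₂).1, heq']

/-! ### The theorem -/

/-- **(G) AT THE PRINCIPAL UP-SET OF A TWO-POINT LINE OF A RANK-5 MATROID ON 8 POINTS**: for every finite matroid
`M` of rank `5` on `8` points and every flat `F₀ = {e, f}` of rank `2`, the signed sum over the separated sets of
`principalUp M F₀` is non-negative («`p` on a triangle» at rank `5`, nullity `4`). -/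
theorem sum_sepSets_principal_line_rank_five_nonneg {F₀ : Finset α} (hF : IsFlatF M F₀) {e f : α} (hef : e ≠ f)
    (hF₀ : F₀ = {e, f}) (hrF : rk M F₀ = 2) (hr : rk M (gr M) = 5) (hN : (gr M).card = 8) :
    0 ≤ ∑ Z ∈ sepSets M (principalUp M F₀), (2 * (Z.card : ℤ) - (gr M).card - 1) := by
  have hN' : (gr M).card + 2 = 2 * rk M (gr M) := by omega
  by_cases hco : ∃ y ∈ gr M, rk M ((gr M).erase y) + 1 = rk M (gr M)
  · obtain ⟨y, hy, hco⟩ := hco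
    have hle : (negTwo M F₀).card ≤ (posTwo M F₀).card := by
      by_cases hyF : y ∈ F₀
      · exact card_negTwo_le_card_posTwo_of_coloop_mem hF hN' hyF hco
      · exact card_negTwo_le_card_posTwo_of_coloop_notMem hF hN' hy hyF hco
    rw [sum_term_eq_of_subset hF hN' (Subset.refl _)]
    have hP : (sepSets M (principalUp M F₀)).filter (fun Z => Z ∈ posTwo M F₀) = posTwo M F₀ := by
      ext Z; rw [mem_filter]; exact ⟨fun h => h.2, fun h => ⟨(mem_posTwo.1 h).1, h⟩⟩
    have hN'' : (sepSets M (principalUp M F₀)).filter (fun Z => Z ∈ negTwo M F₀) = negTwo M F₀ := by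
      ext Z; rw [mem_filter]; exact ⟨fun h => h.2, fun h => ⟨(mem_negTwo.1 h).1, h⟩⟩
    rw [hP, hN'']
    have : ((negTwo M F₀).card : ℤ) ≤ (posTwo M F₀).card := by exact_mod_cast hle
    linarith
  · have hA : ∀ y ∈ gr M, rk M ((gr M).erase y) = rk M (gr M) := by
      intro y hy
      have h1 : rk M ((gr M).erase y) ≤ rk M (gr M) := rk_mono_fu (erase_subset _ _)
      have h2 : rk M (gr M) ≤ rk M ((gr M).erase y) + 1 := by
        have := rk_insert_le (M := M) y ((gr M).erase y); rwa [insert_erase hy] at this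
      by_contra hne
      exact hco ⟨y, hy, by omega⟩
    have heF : e ∈ F₀ := by rw [hF₀]; exact mem_insert_self e {f}
    exact sum_sepSets_principal_nonneg_of_sepBD hF hN' heF
      (sum_sepBD_nonneg_of_no_coloop hF hN' hef hF₀ hrF hr hA)

end PercRepro.Cogirth
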